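import Summits.QuantumFields.YangMills.Theorems.FradkinShenkerFlowStrongPinningPoincareHeatBathGap
import Mathlib.Probability.Moments.Basic
import Mathlib.Analysis.SpecificLimits.Basic
import HarnessLib

/-!
# Robust ball (Y2) — EXPONENTIAL CONCENTRATION FROM A HEAT-BATH POINCARÉ INEQUALITY (Gromov–Milman ∕ Aida–Stroock), uniformly in the volume

HONEST FRAMING: venture file of the cell `pub-ymgap` (QuantumFields programme), track ROBUST-BALL, seat rb-p2 (g13).  Abstract measure theory, importing only
the YangMills summit's heat-bath kernel algebra (`StrongPinningPoincare.HeatBath`) and Mathlib's moment generating function `mgf`.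
* `mgf_le_exp_two_thirds_of_variance_exp_le` — THE GROMOV–MILMAN ∕ AIDA–STROOCK ITERATION: on a probability space, if a bounded measurable `g` with `∫ g = 0`
  satisfies `Var(e^{t g/2}) ≤ (κ t²/4) E e^{t g}` for all `t ≥ 0`, then `E e^{s g} ≤ e^{2/3}` whenever `0 ≤ s`, `κ s² ≤ 1`
  (`(1 − κt²/4) H(t) ≤ H(t/2)²`, iterate, `∏_k (1 − u/4^{k+1})^{−2^k} ≤ e^{2u/(4−u)}`, and `H(s/2^m)^{2^m} → 1` from `|e^x − 1 − x| ≤ x²`);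
  `measureReal_ge_le_of_variance_exp_le` — hence `μ{g ≥ r} ≤ e^{2/3} e^{−r/√κ}`.
* `variance_exp_half_le_of_heatBathPoincare` — for the tilted product measure `μ = (lam^{⊗ι}).tilted V` with a heat-bath Poincaré inequality
  `Var_μ(F) ≤ A ∑_i ∫∫ (F − F∘[i↦e])² dν_i^x dμ` (bounded measurable `F`) and a bounded measurable `f` with per-site oscillations `|f(x) − f(x[i↦e])| ≤ δ_i`:
  `Var_μ(e^{t f/2}) ≤ (2A ∑_i δ_i²) (t²/4) E_μ e^{t f}` (`|e^a − e^b| ≤ |a − b| max(e^a, e^b)` and the DLR identity).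
* ★★★ `measureReal_deviation_ge_le_of_heatBathPoincare` (+ `…_le_…` lower tail) — EXPONENTIAL CONCENTRATION WITH THE ℓ²-NORM OF THE PER-SITE OSCILLATIONS:
  `μ{f − E_μ f ≥ r} ≤ e^{2/3} exp(−r / √(2A ∑_i δ_i²))` — a Poincaré-strength (exponential, not Gaussian) McDiarmid-type inequality, uniform in everything but `A`
  and `∑ δ_i²`.
With the cell's heat-bath Poincaré inequality for `SU(2)`, `d = 4`, `0 ≤ β_W < 2/9` (`A = (2 − 9β_W)⁻¹`, `HeatBathPoincare`) this gives, e.g., for the plaquette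
average `p̄ = |Λ_p|⁻¹ ∑_p ½ Re tr U_p` (`δ_e ≤ 2(d−1)·2/|Λ_p|`): `μ_{β,L}{|p̄ − E p̄| ≥ r} ≤ 2e^{2/3} exp(−r |Λ_p|^{1/2} (2 − 9β_W)^{1/2}/14)`, uniformly in `L` (`∑_e δ_e² ≤ 96/|Λ_p|`) — the
cells are deferred to `HeatBathSweepCells` (gated on the farm lane).  LATTICE statements at STRONG COUPLING; nothing about `β → ∞`, the continuum or Clay.
0 sorry, 0 definitions.  References: M. Gromov, V. D. Milman, Amer. J. Math. 105 (1983) 843–854; S. Aida, D. Stroock, Math. Res. Lett. 1 (1994) 75–86;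
M. Ledoux, The Concentration of Measure Phenomenon (AMS 2001) §3.1; L. Wu, Ann. Probab. 34 (2006) 1960.  Everything here is proved. [folklore]
-/

noncomputable section

open MeasureTheory Function Real Finset ProbabilityTheory Filter Topology
open Summit.QuantumFields.YangMills.Theorems.StrongPinningPoincare

namespace Summit.Ventures.YMGap.RobustBall.HeatBathConcentration

/-! ### The Gromov–Milman ∕ Aida–Stroock iteration -/

section Analytic

variable {Ω : Type*} [MeasurableSpace Ω] (μ : Measure Ω) [IsProbabilityMeasure μ]

/-- **The Gromov–Milman ∕ Aida–Stroock iteration**: on a probability space, a bounded measurable `g` with `∫ g dμ = 0` and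
`Var_μ(e^{t g/2}) ≤ (κ t²/4) E_μ e^{t g}` for all `t ≥ 0` has `E_μ e^{s g} ≤ e^{2/3}` for `0 ≤ s`, `κ s² ≤ 1`. [folklore] -/
theorem mgf_le_exp_two_thirds_of_variance_exp_le {g : Ω → ℝ} (hg : Measurable g) {Mg : ℝ} (hMg : ∀ ω, |g ω| ≤ Mg)
    (hmean : ∫ ω, g ω ∂μ = 0) {κ : ℝ} (hκ : 0 ≤ κ)
    (hvar : ∀ t : ℝ, 0 ≤ t → variance (fun ω => Real.exp (t / 2 * g ω)) μ ≤ κ * t ^ 2 / 4 * mgf g μ t)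
    {s : ℝ} (hs : 0 ≤ s) (hsk : κ * s ^ 2 ≤ 1) : mgf g μ s ≤ Real.exp (2 / 3) := by
  -- `H t = E e^{t g}` is positive and finite
  have hbd : ∀ t ω, |Real.exp (t * g ω)| ≤ Real.exp (|t| * Mg) := fun t ω => by
    rw [abs_of_pos (Real.exp_pos _), Real.exp_le_exp]
    calc t * g ω ≤ |t * g ω| := le_abs_self _
      _ = |t| * |g ω| := abs_mul _ _
      _ ≤ |t| * Mg := mul_le_mul_of_nonneg_left (hMg ω) (abs_nonneg _)
  have hint : ∀ t, Integrable (fun ω => Real.exp (t * g ω)) μ := fun t =>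
    HeatBath.integrable_of_abs_le ((hg.const_mul t).exp) (hbd t)
  have hHpos : ∀ t, 0 < mgf g μ t := fun t => mgf_pos (hint t)
  -- the recursion `(1 − κ t²/4) H t ≤ H(t/2)²`
  have hrec : ∀ t, 0 ≤ t → (1 - κ * t ^ 2 / 4) * mgf g μ t ≤ mgf g μ (t / 2) ^ 2 := by
    intro t ht
    have hv := hvar t ht
    have hmem : MemLp (fun ω => Real.exp (t / 2 * g ω)) 2 μ :=
      MemLp.of_bound ((hg.const_mul _).exp).aestronglyMeasurable (Real.exp (|t / 2| * Mg))
        (ae_of_all _ fun ω => by rw [Real.norm_eq_abs]; exact hbd _ ω)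
    rw [variance_eq_sub hmem] at hv
    have e1 : μ[(fun ω => Real.exp (t / 2 * g ω)) ^ 2] = mgf g μ t := by
      simp only [mgf, Pi.pow_apply]
      refine integral_congr_ae (ae_of_all _ fun ω => ?_)
      show Real.exp (t / 2 * g ω) ^ 2 = Real.exp (t * g ω)
      rw [sq, ← Real.exp_add]
      ring_nf
    have e2 : μ[fun ω => Real.exp (t / 2 * g ω)] = mgf g μ (t / 2) := rfl
    rw [e1, e2] at hv
    nlinarith
  -- the iteration: `H s ≤ exp(∑_{k<m} 2^k x_k/(1 − x_k)) · H(s/2^m)^(2^m)`, `x_k = κ (s/2^k)²/4`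
  set x : ℕ → ℝ := fun k => κ * (s / 2 ^ k) ^ 2 / 4 with hx
  have hxle : ∀ k, x k ≤ 1 / 4 := fun k => by
    simp only [hx]
    have h1 : (s / 2 ^ k) ^ 2 ≤ s ^ 2 := by
      rw [div_pow]
      exact div_le_self (sq_nonneg _) (one_le_pow₀ (one_le_pow₀ (by norm_num : (1 : ℝ) ≤ 2)))
    nlinarith [mul_le_mul_of_nonneg_left h1 hκ]
  have hx0 : ∀ k, 0 ≤ x k := fun k => by simp only [hx]; positivity
  have hiter : ∀ m : ℕ, mgf g μ s ≤ Real.exp (∑ k ∈ Finset.range m, 2 ^ k * (x k / (1 - x k))) * mgf g μ (s / 2 ^ m) ^ (2 ^ m) := by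
    intro m
    induction m with
    | zero => simp
    | succ m ih =>
      have htm : 0 ≤ s / 2 ^ m := by positivity
      have hr := hrec (s / 2 ^ m) htm
      have hhalf : s / 2 ^ m / 2 = s / 2 ^ (m + 1) := by rw [pow_succ]; ring
      rw [hhalf] at hr
      have hxm1 : 0 < 1 - x m := by linarith [hxle m]
      -- `H(s/2^m) ≤ exp(x_m/(1−x_m)) H(s/2^(m+1))²`
      have hstep : mgf g μ (s / 2 ^ m) ≤ Real.exp (x m / (1 - x m)) * mgf g μ (s / 2 ^ (m + 1)) ^ 2 := by
        have hinv : (1 - x m)⁻¹ ≤ Real.exp (x m / (1 - x m)) := by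
          have h := Real.add_one_le_exp (x m / (1 - x m))
          have e : (1 - x m)⁻¹ = x m / (1 - x m) + 1 := by field_simp; ring
          rw [e]; exact h
        have h1 : mgf g μ (s / 2 ^ m) ≤ (1 - x m)⁻¹ * mgf g μ (s / 2 ^ (m + 1)) ^ 2 := by
          rw [← div_eq_inv_mul, le_div_iff₀ hxm1, mul_comm]
          simpa only [hx] using hr
        exact h1.trans (mul_le_mul_of_nonneg_right hinv (sq_nonneg _))
      -- raise to the power `2^m`
      have hpow : mgf g μ (s / 2 ^ m) ^ (2 ^ m) ≤ Real.exp (2 ^ m * (x m / (1 - x m))) * mgf g μ (s / 2 ^ (m + 1)) ^ (2 ^ (m + 1)) := by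
        have h := pow_le_pow_left₀ (hHpos _).le hstep (2 ^ m)
        rw [mul_pow, ← Real.exp_nat_mul, ← pow_mul, show 2 * 2 ^ m = 2 ^ (m + 1) by rw [pow_succ]; ring] at h
        push_cast at h
        exact h
      calc mgf g μ s ≤ Real.exp (∑ k ∈ Finset.range m, 2 ^ k * (x k / (1 - x k))) * mgf g μ (s / 2 ^ m) ^ (2 ^ m) := ih
        _ ≤ Real.exp (∑ k ∈ Finset.range m, 2 ^ k * (x k / (1 - x k))) *
              (Real.exp (2 ^ m * (x m / (1 - x m))) * mgf g μ (s / 2 ^ (m + 1)) ^ (2 ^ (m + 1))) :=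
            mul_le_mul_of_nonneg_left hpow (Real.exp_pos _).le
        _ = Real.exp (∑ k ∈ Finset.range (m + 1), 2 ^ k * (x k / (1 - x k))) * mgf g μ (s / 2 ^ (m + 1)) ^ (2 ^ (m + 1)) := by
            rw [Finset.sum_range_succ, Real.exp_add]; ring
  -- the exponent is `≤ 2/3`
  have hsum : ∀ m : ℕ, ∑ k ∈ Finset.range m, 2 ^ k * (x k / (1 - x k)) ≤ 2 / 3 := by
    intro m
    have h1 : ∀ k ∈ Finset.range m, 2 ^ k * (x k / (1 - x k)) ≤ (κ * s ^ 2 / 3) * (1 / 2) ^ k := fun k _ => by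
      have hk1 : 0 < 1 - x k := by linarith [hxle k]
      have e : (2 : ℝ) ^ k * x k = κ * s ^ 2 / 4 * (1 / 2) ^ k := by
        simp only [hx, div_pow, one_div, inv_pow]
        have h2 : (2 : ℝ) ^ k ≠ 0 := pow_ne_zero _ (by norm_num)
        field_simp
      rw [← mul_div_assoc, e, div_le_iff₀ hk1]
      have h34 : 3 / 4 ≤ 1 - x k := by linarith [hxle k]
      have hq : 0 ≤ κ * s ^ 2 / 3 * (1 / 2 : ℝ) ^ k := by positivity
      nlinarith
    calc ∑ k ∈ Finset.range m, 2 ^ k * (x k / (1 - x k)) ≤ ∑ k ∈ Finset.range m, (κ * s ^ 2 / 3) * (1 / 2 : ℝ) ^ k := Finset.sum_le_sum h1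
      _ = (κ * s ^ 2 / 3) * ∑ k ∈ Finset.range m, (1 / 2 : ℝ) ^ k := by rw [Finset.mul_sum]
      _ ≤ (κ * s ^ 2 / 3) * 2 := mul_le_mul_of_nonneg_left (sum_geometric_two_le m) (by positivity)
      _ ≤ 2 / 3 := by nlinarith
  -- the tail: for `s Mg ≤ 2^m`, `H(s/2^m)^(2^m) ≤ exp(s² Mg² (1/2)^m)`
  have htail : ∀ m : ℕ, s * Mg ≤ 2 ^ m → mgf g μ (s / 2 ^ m) ^ (2 ^ m) ≤ Real.exp (s ^ 2 * Mg ^ 2 * (1 / 2) ^ m) := by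
    intro m hm
    set ε : ℝ := s / 2 ^ m with hε
    have hε0 : 0 ≤ ε := by positivity
    have h2m : (0 : ℝ) < 2 ^ m := by positivity
    have hεM : ε * Mg ≤ 1 := by rw [hε, div_mul_eq_mul_div, div_le_one h2m]; exact hm
    -- `e^{εg} ≤ 1 + εg + ε² Mg²` pointwise
    have hpt : ∀ ω, Real.exp (ε * g ω) ≤ 1 + ε * g ω + ε ^ 2 * Mg ^ 2 := fun ω => by
      have hεg : |ε * g ω| ≤ 1 := by
        rw [abs_mul, abs_of_nonneg hε0]
        exact (mul_le_mul_of_nonneg_left (hMg ω) hε0).trans hεM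
      have h := (abs_le.1 (Real.abs_exp_sub_one_sub_id_le hεg)).2
      have h2 : (ε * g ω) ^ 2 ≤ ε ^ 2 * Mg ^ 2 := by
        rw [mul_pow]
        exact mul_le_mul_of_nonneg_left (by simpa only [sq_abs] using pow_le_pow_left₀ (abs_nonneg _) (hMg ω) 2) (sq_nonneg _)
      linarith
    have hH : mgf g μ ε ≤ 1 + ε ^ 2 * Mg ^ 2 := by
      have hgi : Integrable g μ := HeatBath.integrable_of_abs_le hg hMg
      calc mgf g μ ε = ∫ ω, Real.exp (ε * g ω) ∂μ := rfl
        _ ≤ ∫ ω, (1 + ε * g ω + ε ^ 2 * Mg ^ 2) ∂μ :=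
            integral_mono (hint ε) (((integrable_const _).add (hgi.const_mul ε)).add (integrable_const _)) hpt
        _ = 1 + ε ^ 2 * Mg ^ 2 := by
            have i1 : Integrable (fun ω => 1 + ε * g ω) μ := (integrable_const _).add (hgi.const_mul ε)
            rw [integral_add i1 (integrable_const _), integral_add (integrable_const _) (hgi.const_mul ε), integral_const_mul, hmean]
            simp
    have h1 : 1 + ε ^ 2 * Mg ^ 2 ≤ Real.exp (ε ^ 2 * Mg ^ 2) := by linarith [Real.add_one_le_exp (ε ^ 2 * Mg ^ 2)]
    calc mgf g μ ε ^ (2 ^ m) ≤ Real.exp (ε ^ 2 * Mg ^ 2) ^ (2 ^ m) := pow_le_pow_left₀ (hHpos ε).le (hH.trans h1) _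
      _ = Real.exp (s ^ 2 * Mg ^ 2 * (1 / 2) ^ m) := by
          rw [← Real.exp_nat_mul]
          congr 1
          rw [hε, div_pow, one_div, inv_pow]
          push_cast
          field_simp
  -- conclusion: `H s ≤ e^{2/3} exp(s² Mg² (1/2)^m)` eventually, and the right side tends to `e^{2/3}`
  have hev : ∀ᶠ m : ℕ in atTop, mgf g μ s ≤ Real.exp (2 / 3) * Real.exp (s ^ 2 * Mg ^ 2 * (1 / 2) ^ m) := by
    obtain ⟨m₀, hm₀⟩ := pow_unbounded_of_one_lt (s * Mg) (by norm_num : (1 : ℝ) < 2)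
    refine eventually_atTop.2 ⟨m₀, fun m hm => ?_⟩
    have hm' : s * Mg ≤ 2 ^ m := hm₀.le.trans (pow_le_pow_right₀ (by norm_num) hm)
    calc mgf g μ s ≤ Real.exp (∑ k ∈ Finset.range m, 2 ^ k * (x k / (1 - x k))) * mgf g μ (s / 2 ^ m) ^ (2 ^ m) := hiter m
      _ ≤ Real.exp (2 / 3) * Real.exp (s ^ 2 * Mg ^ 2 * (1 / 2) ^ m) :=
          mul_le_mul (Real.exp_le_exp.2 (hsum m)) (htail m hm') (pow_nonneg (hHpos _).le _) (Real.exp_pos _).le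
  have hlim : Tendsto (fun m : ℕ => Real.exp (2 / 3) * Real.exp (s ^ 2 * Mg ^ 2 * (1 / 2) ^ m)) atTop (𝓝 (Real.exp (2 / 3))) := by
    have h0 : Tendsto (fun m : ℕ => s ^ 2 * Mg ^ 2 * (1 / 2 : ℝ) ^ m) atTop (𝓝 (s ^ 2 * Mg ^ 2 * 0)) :=
      (tendsto_pow_atTop_nhds_zero_of_lt_one (by norm_num) (by norm_num)).const_mul _
    rw [mul_zero] at h0
    have h1 := (Real.continuous_exp.tendsto 0).comp h0
    rw [Real.exp_zero] at h1
    simpa using h1.const_mul (Real.exp (2 / 3))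
  exact ge_of_tendsto hlim hev

/-- **Exponential tail from the iteration**: under the hypotheses of `mgf_le_exp_two_thirds_of_variance_exp_le` with `κ > 0`,
`μ{g ≥ r} ≤ e^{2/3} e^{−r/√κ}` for every `r`. [folklore] -/
theorem measureReal_ge_le_of_variance_exp_le {g : Ω → ℝ} (hg : Measurable g) {Mg : ℝ} (hMg : ∀ ω, |g ω| ≤ Mg)
    (hmean : ∫ ω, g ω ∂μ = 0) {κ : ℝ} (hκ : 0 < κ)
    (hvar : ∀ t : ℝ, 0 ≤ t → variance (fun ω => Real.exp (t / 2 * g ω)) μ ≤ κ * t ^ 2 / 4 * mgf g μ t) (r : ℝ) :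
    μ.real {ω | r ≤ g ω} ≤ Real.exp (2 / 3) * Real.exp (-r / Real.sqrt κ) := by
  have hsq : 0 < Real.sqrt κ := Real.sqrt_pos.2 hκ
  set s : ℝ := (Real.sqrt κ)⁻¹ with hs
  have hs0 : 0 ≤ s := by positivity
  have hsk : κ * s ^ 2 ≤ 1 := by
    rw [hs, inv_pow, Real.sq_sqrt hκ.le, mul_inv_cancel₀ hκ.ne']
  have hbd : ∀ ω, |Real.exp (s * g ω)| ≤ Real.exp (|s| * Mg) := fun ω => by
    rw [abs_of_pos (Real.exp_pos _), Real.exp_le_exp]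
    calc s * g ω ≤ |s * g ω| := le_abs_self _
      _ = |s| * |g ω| := abs_mul _ _
      _ ≤ |s| * Mg := mul_le_mul_of_nonneg_left (hMg ω) (abs_nonneg _)
  have hint : Integrable (fun ω => Real.exp (s * g ω)) μ := HeatBath.integrable_of_abs_le ((hg.const_mul s).exp) hbd
  have h1 := measure_ge_le_exp_mul_mgf r hs0 hint
  have h2 := mgf_le_exp_two_thirds_of_variance_exp_le μ hg hMg hmean hκ.le hvar hs0 hsk
  have e : -s * r = -r / Real.sqrt κ := by rw [hs]; ring
  rw [e] at h1
  calc μ.real {ω | r ≤ g ω} ≤ Real.exp (-r / Real.sqrt κ) * mgf g μ s := h1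
    _ ≤ Real.exp (-r / Real.sqrt κ) * Real.exp (2 / 3) := mul_le_mul_of_nonneg_left h2 (Real.exp_pos _).le
    _ = Real.exp (2 / 3) * Real.exp (-r / Real.sqrt κ) := mul_comm _ _

end Analytic

/-! ### The heat-bath route: per-site oscillations -/

section HeatBath

variable {ι : Type*} [Fintype ι] [DecidableEq ι] {E : Type*} [MeasurableSpace E]
  (lam : Measure E) [IsProbabilityMeasure lam] {V : (ι → E) → ℝ}

/-- **`Var_μ(e^{t f/2}) ≤ (2A ∑_i δ_i²)(t²/4) E_μ e^{t f}`** for the tilted product measure `μ = (lam^{⊗ι}).tilted V` under a heat-bath Poincaré inequality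
with constant `A` and a bounded measurable `f` with per-site oscillations `|f(x) − f(x[i↦e])| ≤ δ_i` (`|e^a − e^b| ≤ |a−b| max(e^a,e^b)`, `max² ≤ e^{2a} + e^{2b}`,
and the DLR identity `∫∫ φ(x[i↦e]) dν_i^x dμ = ∫ φ dμ`). [folklore] -/
theorem variance_exp_half_le_of_heatBathPoincare (hV : Measurable V) {Bv : ℝ} (hB : ∀ x, |V x| ≤ Bv) {A : ℝ}
    (hP : ∀ (F : (ι → E) → ℝ), Measurable F → (∃ M : ℝ, ∀ x, |F x| ≤ M) →
      variance F ((Measure.pi fun _ : ι => lam).tilted V) ≤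
        A * ∑ i, ∫ x, ∫ e, (F x - F (update x i e)) ^ 2 ∂(lam.tilted fun e => V (update x i e)) ∂((Measure.pi fun _ : ι => lam).tilted V))
    (hA : 0 ≤ A) {f : (ι → E) → ℝ} (hf : Measurable f) {M : ℝ} (hM : ∀ x, |f x| ≤ M) (δ : ι → ℝ)
    (hδ : ∀ i x e, |f x - f (update x i e)| ≤ δ i) (t : ℝ) :
    variance (fun x => Real.exp (t / 2 * f x)) ((Measure.pi fun _ : ι => lam).tilted V) ≤
      (2 * A * ∑ i, δ i ^ 2) * t ^ 2 / 4 * mgf f ((Measure.pi fun _ : ι => lam).tilted V) t := by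
  haveI := HeatBath.isProbabilityMeasure_gibbs lam hV hB
  set μ := (Measure.pi fun _ : ι => lam).tilted V with hμ
  set F : (ι → E) → ℝ := fun x => Real.exp (t / 2 * f x) with hF
  have hbdexp : ∀ (c : ℝ) (y : ι → E), |Real.exp (c * f y)| ≤ Real.exp (|c| * M) := fun c y => by
    rw [abs_of_pos (Real.exp_pos _), Real.exp_le_exp]
    calc c * f y ≤ |c * f y| := le_abs_self _
      _ = |c| * |f y| := abs_mul _ _
      _ ≤ |c| * M := mul_le_mul_of_nonneg_left (hM y) (abs_nonneg _)
  have hFm : Measurable F := (hf.const_mul _).exp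
  have hFb : ∀ x, |F x| ≤ Real.exp (|t / 2| * M) := fun x => hbdexp _ x
  have hPF := hP F hFm ⟨_, hFb⟩
  -- pointwise: `(F x − F x')² ≤ (t²/4) δ_i² (e^{t f x} + e^{t f x'})`
  have hpt : ∀ i x e, (F x - F (update x i e)) ^ 2 ≤
      t ^ 2 / 4 * δ i ^ 2 * (Real.exp (t * f x) + Real.exp (t * f (update x i e))) := by
    intro i x e
    -- `|e^a − e^b| ≤ |a − b| max(e^a, e^b)` (also pub-balaban's `ResolventFinCertificate.abs_exp_sub_exp_le`; re-derived to keep the imports minimal)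
    have habs : ∀ a b : ℝ, |Real.exp a - Real.exp b| ≤ |a - b| * max (Real.exp a) (Real.exp b) := by
      have key : ∀ {a b : ℝ}, b ≤ a → Real.exp a - Real.exp b ≤ (a - b) * Real.exp a := fun {a b} hab => by
        have h1 : (1 - (a - b)) * Real.exp (a - b) ≤ 1 := by
          have h := Real.add_one_le_exp (-(a - b))
          have h' : Real.exp (-(a - b)) * Real.exp (a - b) = 1 := by rw [← Real.exp_add]; simp
          nlinarith [Real.exp_pos (a - b), Real.exp_pos (-(a - b))]
        have h2 : Real.exp a = Real.exp b * Real.exp (a - b) := by rw [← Real.exp_add]; ring_nf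
        rw [h2]
        nlinarith [Real.exp_pos b, Real.exp_pos (a - b)]
      intro a b
      rcases le_total b a with hab | hab
      · rw [abs_of_nonneg (sub_nonneg.2 (Real.exp_le_exp.2 hab)), abs_of_nonneg (sub_nonneg.2 hab)]
        exact (key hab).trans (mul_le_mul_of_nonneg_left (le_max_left _ _) (sub_nonneg.2 hab))
      · rw [abs_of_nonpos (sub_nonpos.2 (Real.exp_le_exp.2 hab)), abs_of_nonpos (sub_nonpos.2 hab), neg_sub, neg_sub]
        exact (key hab).trans (mul_le_mul_of_nonneg_left (le_max_right _ _) (sub_nonneg.2 hab))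
    set a : ℝ := t / 2 * f x with ha
    set b : ℝ := t / 2 * f (update x i e) with hb
    have h1 := habs a b
    have hd : |a - b| ≤ |t| / 2 * δ i := by
      rw [ha, hb, ← mul_sub, abs_mul, abs_div, abs_two]
      exact mul_le_mul_of_nonneg_left (hδ i x e) (by positivity)
    have hmax0 : 0 ≤ max (Real.exp a) (Real.exp b) := (Real.exp_pos a).le.trans (le_max_left _ _)
    have hea : Real.exp a ^ 2 = Real.exp (t * f x) := by rw [ha, sq, ← Real.exp_add]; ring_nf
    have heb : Real.exp b ^ 2 = Real.exp (t * f (update x i e)) := by rw [hb, sq, ← Real.exp_add]; ring_nf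
    have hmaxsq : max (Real.exp a) (Real.exp b) ^ 2 ≤ Real.exp (t * f x) + Real.exp (t * f (update x i e)) := by
      rcases le_total (Real.exp a) (Real.exp b) with h | h
      · rw [max_eq_right h, heb]; linarith [Real.exp_pos (t * f x)]
      · rw [max_eq_left h, hea]; linarith [Real.exp_pos (t * f (update x i e))]
    calc (F x - F (update x i e)) ^ 2 = |Real.exp a - Real.exp b| ^ 2 := (sq_abs _).symm
      _ ≤ (|a - b| * max (Real.exp a) (Real.exp b)) ^ 2 := pow_le_pow_left₀ (abs_nonneg _) h1 2
      _ ≤ (|t| / 2 * δ i * max (Real.exp a) (Real.exp b)) ^ 2 :=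
          pow_le_pow_left₀ (mul_nonneg (abs_nonneg _) hmax0) (mul_le_mul_of_nonneg_right hd hmax0) 2
      _ = t ^ 2 / 4 * δ i ^ 2 * max (Real.exp a) (Real.exp b) ^ 2 := by rw [mul_pow, mul_pow, div_pow, sq_abs]; ring
      _ ≤ t ^ 2 / 4 * δ i ^ 2 * (Real.exp (t * f x) + Real.exp (t * f (update x i e))) :=
          mul_le_mul_of_nonneg_left hmaxsq (by positivity)
  -- integrate in `e`
  have hm1 : Measurable fun y => Real.exp (t * f y) := (hf.const_mul t).exp
  have hb1 : ∀ y, |Real.exp (t * f y)| ≤ Real.exp (|t| * M) := fun y => hbdexp t y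
  have hinner : ∀ i x, ∫ e, (F x - F (update x i e)) ^ 2 ∂(lam.tilted fun e => V (update x i e)) ≤
      t ^ 2 / 4 * δ i ^ 2 * (Real.exp (t * f x) + ∫ e, Real.exp (t * f (update x i e)) ∂(lam.tilted fun e => V (update x i e))) := by
    intro i x
    haveI := HeatBath.isProbabilityMeasure_heatBath lam hV hB x i
    have hgi : Integrable (fun e => Real.exp (t * f (update x i e))) (lam.tilted fun e => V (update x i e)) :=
      HeatBath.integrable_of_abs_le (hm1.comp (measurable_update x)) fun e => hb1 _
    calc ∫ e, (F x - F (update x i e)) ^ 2 ∂(lam.tilted fun e => V (update x i e))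
        ≤ ∫ e, t ^ 2 / 4 * δ i ^ 2 * (Real.exp (t * f x) + Real.exp (t * f (update x i e))) ∂(lam.tilted fun e => V (update x i e)) :=
          integral_mono_of_nonneg (ae_of_all _ fun e => sq_nonneg _) (((integrable_const _).add hgi).const_mul _) (ae_of_all _ fun e => hpt i x e)
      _ = t ^ 2 / 4 * δ i ^ 2 * (Real.exp (t * f x) + ∫ e, Real.exp (t * f (update x i e)) ∂(lam.tilted fun e => V (update x i e))) := by
          rw [integral_const_mul, integral_add (integrable_const _) hgi]
          simp [integral_const, probReal_univ]
  -- integrate in `x` (DLR)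
  have houter : ∀ i, ∫ x, ∫ e, (F x - F (update x i e)) ^ 2 ∂(lam.tilted fun e => V (update x i e)) ∂μ ≤
      t ^ 2 / 4 * δ i ^ 2 * (mgf f μ t + mgf f μ t) := by
    intro i
    have hPim : Measurable fun x => ∫ e, Real.exp (t * f (update x i e)) ∂(lam.tilted fun e => V (update x i e)) :=
      HeatBath.measurable_heatBath lam hV i hm1
    have hPib : ∀ x, |∫ e, Real.exp (t * f (update x i e)) ∂(lam.tilted fun e => V (update x i e))| ≤ Real.exp (|t| * M) :=
      fun x => HeatBath.abs_heatBath_le lam hV hB x i hb1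
    have i1 : Integrable (fun x => Real.exp (t * f x)) μ := HeatBath.integrable_of_abs_le hm1 hb1
    have i2 : Integrable (fun x => ∫ e, Real.exp (t * f (update x i e)) ∂(lam.tilted fun e => V (update x i e))) μ :=
      HeatBath.integrable_of_abs_le hPim hPib
    have hup : Integrable (fun x => t ^ 2 / 4 * δ i ^ 2 *
        (Real.exp (t * f x) + ∫ e, Real.exp (t * f (update x i e)) ∂(lam.tilted fun e => V (update x i e)))) μ := (i1.add i2).const_mul _
    calc ∫ x, ∫ e, (F x - F (update x i e)) ^ 2 ∂(lam.tilted fun e => V (update x i e)) ∂μ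
        ≤ ∫ x, t ^ 2 / 4 * δ i ^ 2 * (Real.exp (t * f x) + ∫ e, Real.exp (t * f (update x i e)) ∂(lam.tilted fun e => V (update x i e))) ∂μ :=
          integral_mono_of_nonneg (ae_of_all _ fun x => integral_nonneg fun e => sq_nonneg _) hup (ae_of_all _ fun x => hinner i x)
      _ = t ^ 2 / 4 * δ i ^ 2 * (mgf f μ t + mgf f μ t) := by
          rw [integral_const_mul, integral_add i1 i2, HeatBath.integral_heatBath lam hV hB i hm1 hb1]
          rfl
  -- sum over the sites
  have hsum : ∑ i, ∫ x, ∫ e, (F x - F (update x i e)) ^ 2 ∂(lam.tilted fun e => V (update x i e)) ∂μ ≤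
      ∑ i, t ^ 2 / 4 * δ i ^ 2 * (mgf f μ t + mgf f μ t) := Finset.sum_le_sum fun i _ => houter i
  have e : ∑ i, t ^ 2 / 4 * δ i ^ 2 * (mgf f μ t + mgf f μ t) = (2 * ∑ i, δ i ^ 2) * t ^ 2 / 4 * mgf f μ t := by
    rw [Finset.mul_sum, Finset.sum_mul, Finset.sum_div, Finset.sum_mul]
    exact Finset.sum_congr rfl fun i _ => by ring
  calc variance F μ ≤ A * ∑ i, ∫ x, ∫ e, (F x - F (update x i e)) ^ 2 ∂(lam.tilted fun e => V (update x i e)) ∂μ := hPF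
    _ ≤ A * ((2 * ∑ i, δ i ^ 2) * t ^ 2 / 4 * mgf f μ t) := mul_le_mul_of_nonneg_left (hsum.trans e.le) hA
    _ = (2 * A * ∑ i, δ i ^ 2) * t ^ 2 / 4 * mgf f μ t := by ring

/-- ★★★ **EXPONENTIAL CONCENTRATION FROM A HEAT-BATH POINCARÉ INEQUALITY, WITH THE ℓ²-NORM OF THE PER-SITE OSCILLATIONS** (upper tail): for the tilted product
measure `μ` with `Var_μ(F) ≤ A ∑_i ∫∫ (F − F∘[i↦e])² dν_i^x dμ` (bounded measurable `F`, `A > 0`) and a bounded measurable `f` with `|f(x) − f(x[i↦e])| ≤ δ_i`,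
`∑ δ_i² > 0`: `μ{f − E_μ f ≥ r} ≤ e^{2/3} exp(−r / √(2A ∑_i δ_i²))` for every `r`. [folklore] -/
theorem measureReal_deviation_ge_le_of_heatBathPoincare [Nonempty ι] (hV : Measurable V) {Bv : ℝ} (hB : ∀ x, |V x| ≤ Bv) {A : ℝ}
    (hP : ∀ (F : (ι → E) → ℝ), Measurable F → (∃ M : ℝ, ∀ x, |F x| ≤ M) →
      variance F ((Measure.pi fun _ : ι => lam).tilted V) ≤
        A * ∑ i, ∫ x, ∫ e, (F x - F (update x i e)) ^ 2 ∂(lam.tilted fun e => V (update x i e)) ∂((Measure.pi fun _ : ι => lam).tilted V))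
    (hA : 0 < A) {f : (ι → E) → ℝ} (hf : Measurable f) {M : ℝ} (hM : ∀ x, |f x| ≤ M) (δ : ι → ℝ)
    (hδ : ∀ i x e, |f x - f (update x i e)| ≤ δ i) (hD : 0 < ∑ i, δ i ^ 2) (r : ℝ) :
    ((Measure.pi fun _ : ι => lam).tilted V).real {x | r ≤ f x - ∫ y, f y ∂((Measure.pi fun _ : ι => lam).tilted V)} ≤
      Real.exp (2 / 3) * Real.exp (-r / Real.sqrt (2 * A * ∑ i, δ i ^ 2)) := by
  haveI := HeatBath.isProbabilityMeasure_gibbs lam hV hB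
  set μ := (Measure.pi fun _ : ι => lam).tilted V with hμ
  set m : ℝ := ∫ y, f y ∂μ with hm
  set g : (ι → E) → ℝ := fun x => f x - m with hg
  have hgm : Measurable g := hf.sub measurable_const
  have hgb : ∀ x, |g x| ≤ M + |m| := fun x => (abs_sub _ _).trans (add_le_add (hM x) le_rfl)
  have hmean : ∫ x, g x ∂μ = 0 := by
    simp only [hg]
    rw [integral_sub (HeatBath.integrable_of_abs_le hf hM) (integrable_const _), integral_const, probReal_univ, one_smul, ← hm, sub_self]
  have hδg : ∀ i x e, |g x - g (update x i e)| ≤ δ i := fun i x e => by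
    simp only [hg, sub_sub_sub_cancel_right]
    exact hδ i x e
  have hκ : 0 < 2 * A * ∑ i, δ i ^ 2 := by positivity
  have hvar : ∀ t : ℝ, 0 ≤ t → variance (fun x => Real.exp (t / 2 * g x)) μ ≤ (2 * A * ∑ i, δ i ^ 2) * t ^ 2 / 4 * mgf g μ t :=
    fun t _ => variance_exp_half_le_of_heatBathPoincare lam hV hB hP hA.le hgm hgb δ hδg t
  exact measureReal_ge_le_of_variance_exp_le μ hgm hgb hmean hκ hvar r

/-- ★★★ **EXPONENTIAL CONCENTRATION, lower tail**: under the same hypotheses, `μ{f − E_μ f ≤ −r} ≤ e^{2/3} exp(−r / √(2A ∑_i δ_i²))`. [folklore] -/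
theorem measureReal_deviation_le_le_of_heatBathPoincare [Nonempty ι] (hV : Measurable V) {Bv : ℝ} (hB : ∀ x, |V x| ≤ Bv) {A : ℝ}
    (hP : ∀ (F : (ι → E) → ℝ), Measurable F → (∃ M : ℝ, ∀ x, |F x| ≤ M) →
      variance F ((Measure.pi fun _ : ι => lam).tilted V) ≤
        A * ∑ i, ∫ x, ∫ e, (F x - F (update x i e)) ^ 2 ∂(lam.tilted fun e => V (update x i e)) ∂((Measure.pi fun _ : ι => lam).tilted V))
    (hA : 0 < A) {f : (ι → E) → ℝ} (hf : Measurable f) {M : ℝ} (hM : ∀ x, |f x| ≤ M) (δ : ι → ℝ)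
    (hδ : ∀ i x e, |f x - f (update x i e)| ≤ δ i) (hD : 0 < ∑ i, δ i ^ 2) (r : ℝ) :
    ((Measure.pi fun _ : ι => lam).tilted V).real {x | f x - ∫ y, f y ∂((Measure.pi fun _ : ι => lam).tilted V) ≤ -r} ≤
      Real.exp (2 / 3) * Real.exp (-r / Real.sqrt (2 * A * ∑ i, δ i ^ 2)) := by
  haveI := HeatBath.isProbabilityMeasure_gibbs lam hV hB
  set μ := (Measure.pi fun _ : ι => lam).tilted V with hμ
  have hnm : Measurable fun x => -f x := hf.neg
  have hnb : ∀ x, |(-f x)| ≤ M := fun x => by rw [abs_neg]; exact hM x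
  have hnδ : ∀ i x e, |(-f x) - (-f (update x i e))| ≤ δ i := fun i x e => by
    rw [← abs_neg]
    convert hδ i x e using 2
    ring
  have h := measureReal_deviation_ge_le_of_heatBathPoincare lam hV hB hP hA hnm hnb δ hnδ hD r
  have hset : {x | r ≤ -f x - ∫ y, -f y ∂μ} = {x | f x - ∫ y, f y ∂μ ≤ -r} := by
    ext x
    simp only [Set.mem_setOf_eq, integral_neg]
    constructor <;> intro hx <;> linarith
  rw [hset] at h
  exact h

end HeatBath

end Summit.Ventures.YMGap.RobustBall.HeatBathConcentration

end
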